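import Summits.ResolutionOfSingularities.ResolutionOfSingularities.Theorems.PurelyInseparableDim4ResConeHeavyLineKeepStep
import Summits.ResolutionOfSingularities.ResolutionOfSingularities.Theorems.PurelyInseparableDim4ResConeFourWeightsRecurrence
import Summits.ResolutionOfSingularities.ResolutionOfSingularities.Theorems.PurelyInseparableDim4ResConeHeavyLoseStep
import HarnessLib
import HarnessLib.Audit.Tags

/-!
# The `(p, p−1)` heavy line, ASSEMBLY (p-GENERIC): a frame-carried potential dropping strictly at `(2)`-states and weakly at
# `(2,1)`-states kills the heavy class; instantiated with K_p discharged, so the class is empty GIVEN the entry law E_p and the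
# LOSE-H law L_p (cell `res-dim4-pi`, K2(p) lane, slice C `(p, p−1)`; CARD I-1-9/I-1-10 «THE HEAVY LINE»; HOLDER WORD 2026-08-29
# 08:08Z «(p, p−1) D∞-type heavy line ⟸ W_{p−1}-pattern, p-GENERIC»; kernel hand res-dim4-p-7 g5)

[OURS · counted 0 · cell `res-dim4-pi` · K2(p) lane (holder res-dim4-p-12 g4); the p-generic twins of `…ResConeDInfPotential` (p706494)
and `…ResConeDInfAssembly` (p707409); kernel hand res-dim4-p-7 g5.]  Nothing here proves K2(p), K2(7), `NoIsolatedTrap p p` or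
resolution of singularities in dimension ≥ 4 / characteristic `p` — NOT proved; E_p and L_p are HYPOTHESES, and at `p ≥ 7` so is
the CLASS binder itself (at `p = 5` it is W₄'s D∞ branch).  AI kernel work, weaker than expert review.

THE CLASS binder (as in `…HeavyLineFrames`): from `k₁ ≥ k₀` one letter of weight `2`, the others `≤ 1`, `2 ≤ |r_k| ≤ 3`.  Two facts
W₄ proved by band layers at `p = 5` are obtained here p-GENERICALLY from the class and the free-tail theorem FT
(`ResCone.no_tail_of_eventually_free`, ‖ K): (entry) every `(2)`-state is followed by a `(2,1)`-state
(`heavyLine_succ_degree_three_of_two`); (dock) the `(2)`-states cannot be bounded in number — else the tail is `(2,1)^ω`, every step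
hits the letter born at the previous step (`heavyLine_hit_of_class` twice), i.e. the tail is FREE, excluded by FT.

* **`no_heavyLine_tail_of_potential (p)`** — class × (E)(L)(K)(RE) for ANY datum type / ℕ-potential ⟹ `False`;
* **`no_heavyLine_tail_of_EL (p)`** — the instantiation with datum (heavy letter, frame, inverse), `E := EntryInv_p`, `R := RunInv_p`
  (interface of `…HeavyLineKeepStep`: numerals of res-dim4-p-2's `heavy_lose_step` with `n = d − 1`), `Φ := betaS`, and (K) DISCHARGED by `heavyLine_stub_keep`: the heavy class is
  empty GIVEN `hE` (entry frame at a `(2,1)`-state, res-dim4-p-9's `stub_entryFrame₄` pattern) and `hL` (LOSE-H law, res-dim4-p-2's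
  `dInf_stub_lose` pattern), both quantified over `k ≥ k₁` so that their proofs may use the class binder;
* **`no_heavyLine_tail (p)`** — E_p := res-dim4-p-9 g5's `heavy_entryFrame` (transversality from `heavyLine_hit_of_class`) and
  L_p := res-dim4-p-2 g5's `heavy_lose_step` (factorisations from `tail_factorisation`/`tail_step_factorisation`, pattern from
  `heavyLine_hit_of_class`, numerology from `d + 1 = p`) DISCHARGE `hE`/`hL`: **for every prime `p ≥ 3` the `(p, p−1)` D∞-shape class
  carries no witnessed isolated above-floor `Step0 p` chain** — the heavy line of CARD I-1-9/I-1-10 ‖ K at every prime, as a theorem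
  whose only residual hypothesis is the class binder `hD` itself (discharged at `p = 5` by W₄; a HYPOTHESIS at `p ≥ 7`).
[cite: CossartJannsenSaito2020, Thm. 3.14, Lemma 13.4 (3), Thm. 13.7] [cite: CossartPiltant2008, (16)] [cite: HauserPerlega2019PRIMS, §2 (transform D′ of D)]
bears_on: LADDER-RESOLUTION:D157-DOOR2 (res-dim4-pi · K2(p) · slice C (p, p−1) heavy-line assembly).  Supports
stmt-ResolutionOfSingularities-16155 (helper).
-/

set_option linter.dupNamespace false -- mandated namespace of this single-conjunct summit

noncomputable section

namespace Summit.ResolutionOfSingularities.ResolutionOfSingularities.Theorems.PIDim4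

namespace ResCone

open MvPolynomial Finset
open Literature.AlgebraicGeometry.Resolution
open Literature.AlgebraicGeometry.Resolution.CentreBlowup
open Literature.AlgebraicGeometry.Resolution.Hauser2010
open Literature.AlgebraicGeometry.Resolution.HauserPerlega2019
open Literature.AlgebraicGeometry.Resolution.WeightedOrder

variable {K : Type} [Field K] (p : ℕ) [hp : Fact p.Prime] [CharP K p] [DecidableEq K]

/-- **THE `(p, p−1)` HEAVY-LINE ASSEMBLY IN POTENTIAL FORM (p-GENERIC).**  Along a witnessed isolated above-floor `Step0 p` chain with
constant shade `d`, `d + 1 = p`, from `k₀`, in the heavy class from `k₁ ≥ k₀`: suppose a datum type `Fr` with ENTRY/RUN predicates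
`E R` and a potential `Φ` satisfies (E) at every `(2,1)`-state an entry datum exists; (L) at every `(2,1)`-state an entry datum yields a
run datum of the child with `Φ` not larger; (K) at every `(2)`-state a run datum yields a run datum of the child with `Φ` strictly
smaller; (RE) run data are entry data.  Then `False`: the run data bound the number of `(2)`-states, so the tail is eventually
`(2,1)^ω`, hence free (each step hits the letter born just before), against FT. [OURS] [cite: CossartJannsenSaito2020, Thm. 3.14, Thm. 13.7] -/
theorem no_heavyLine_tail_of_potential {c : ℕ → State K} {j : ℕ → Fin 4} {b : ℕ → Fin 4 → K}
    (hc : ∀ k, IsIsolated p (c k).F ∧ Step0 p (c k) (c (k + 1))) (hw : FreeTail.IsWitnessedChain p c j b)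
    (hr0 : ∀ e ∈ (c 0).F.support, (c 0).r ≤ e) (hfloor : ∀ k, ordZero (c k).F ≠ p) {k₀ d : ℕ} (hdp : d + 1 = p)
    (hshade : ∀ k, k₀ ≤ k → (c k).shade = (d : ℕ∞)) {k₁ : ℕ} (hk₁ : k₀ ≤ k₁)
    (hD : ∀ k, k₁ ≤ k → (∃ W, (c k).r W = 2 ∧ ∀ i, i ≠ W → (c k).r i ≤ 1) ∧
      (2 ≤ (c k).r.degree ∧ (c k).r.degree ≤ 3))
    {Fr : Type} (E R : ℕ → Fr → Prop) (Φ : ℕ → Fr → ℕ)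
    (hE : ∀ k, k₁ ≤ k → (c k).r.degree = 3 → ∃ f, E k f)
    (hL : ∀ k, k₁ ≤ k → (c k).r.degree = 3 → ∀ f, E k f → ∃ f', R (k + 1) f' ∧ Φ (k + 1) f' ≤ Φ k f)
    (hK : ∀ k, k₁ ≤ k → (c k).r.degree = 2 → ∀ f, R k f → ∃ f', R (k + 1) f' ∧ Φ (k + 1) f' < Φ k f)
    (hRE : ∀ k f, R k f → E k f) : False := by
  classical
  obtain ⟨-, hlaw, -, -, -⟩ := tail_weights_laws hc hw hr0 hfloor hshade
  have hlaw₁ : ∀ k, k₁ ≤ k →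
      (c (k + 1)).r = ((c k).r.filter (fun i => b k i = 0)).update (j k) ((c k).r.degree + d - p) :=
    fun k hk => hlaw k (by omega)
  have hfl₁ : ∀ k, k₁ ≤ k → 2 ≤ (c k).r.degree := fun k hk => (hD k hk).2.1
  have hcl₁ : ∀ k, k₁ ≤ k → ∃ W, (c k).r W = 2 ∧ ∀ i, i ≠ W → (c k).r i ≤ 1 := fun k hk => (hD k hk).1
  -- an entry `(2,1)`-state `kₑ ∈ {k₁, k₁ + 1}`
  have hentry : ∃ kₑ, k₁ ≤ kₑ ∧ (c kₑ).r.degree = 3 := by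
    obtain ⟨⟨W, hW, -⟩, hge, hle⟩ := hD k₁ le_rfl
    by_cases h3 : (c k₁).r.degree = 3
    · exact ⟨k₁, le_rfl, h3⟩
    · exact ⟨k₁ + 1, by omega, heavyLine_succ_degree_three_of_two (r := fun k => (c k).r) hdp hlaw₁ hfl₁ le_rfl (by omega) hW⟩
  obtain ⟨kₑ, hkₑ, h3⟩ := hentry
  obtain ⟨fₑ, hfₑ⟩ := hE kₑ hkₑ h3
  obtain ⟨f₀, hR₀, -⟩ := hL kₑ hkₑ h3 fₑ hfₑ
  -- propagate: at time `kₑ + 1 + n` a run datum with `#(2)-states so far + Φ ≤ Φ₀`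
  have hprop : ∀ n, ∃ f, R (kₑ + 1 + n) f ∧
      ((Finset.range n).filter (fun i => (c (kₑ + 1 + i)).r.degree = 2)).card + Φ (kₑ + 1 + n) f ≤ Φ (kₑ + 1) f₀ := by
    intro n
    induction n with
    | zero => exact ⟨f₀, by simpa using hR₀, by simp⟩
    | succ n ih =>
      obtain ⟨f, hRf, hbound⟩ := ih
      have hk : k₁ ≤ kₑ + 1 + n := by omega
      have hcard : ((Finset.range (n + 1)).filter (fun i => (c (kₑ + 1 + i)).r.degree = 2)).card =
          ((Finset.range n).filter (fun i => (c (kₑ + 1 + i)).r.degree = 2)).card +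
            (if (c (kₑ + 1 + n)).r.degree = 2 then 1 else 0) := by
        rw [Finset.range_add_one, Finset.filter_insert]
        split_ifs with h2
        · rw [Finset.card_insert_of_notMem (by simp)]
        · rfl
      have heq : kₑ + 1 + (n + 1) = kₑ + 1 + n + 1 := by ring
      obtain ⟨-, hge2, hle3⟩ := hD (kₑ + 1 + n) hk
      by_cases h2 : (c (kₑ + 1 + n)).r.degree = 2
      · obtain ⟨f', hR', hlt⟩ := hK _ hk h2 f hRf
        refine ⟨f', by rw [heq]; exact hR', ?_⟩
        rw [hcard, if_pos h2, heq]
        omega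
      · have h3' : (c (kₑ + 1 + n)).r.degree = 3 := by omega
        obtain ⟨f', hR', hle⟩ := hL _ hk h3' f (hRE _ _ hRf)
        refine ⟨f', by rw [heq]; exact hR', ?_⟩
        rw [hcard, if_neg h2, heq]
        omega
  -- hence the `(2)`-states are eventually absent …
  have hev : ∃ k₂, kₑ + 1 ≤ k₂ ∧ ∀ k, k₂ ≤ k → (c k).r.degree ≠ 2 := by
    by_contra hno
    push Not at hno
    have hgrow : ∀ m, ∃ n, m ≤ ((Finset.range n).filter (fun i => (c (kₑ + 1 + i)).r.degree = 2)).card := by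
      intro m
      induction m with
      | zero => exact ⟨0, Nat.zero_le _⟩
      | succ m ih =>
        obtain ⟨n, hn⟩ := ih
        obtain ⟨k, hk, h2⟩ := hno (kₑ + 1 + n) (by omega)
        refine ⟨k - (kₑ + 1) + 1, ?_⟩
        have hsub : (Finset.range n).filter (fun i => (c (kₑ + 1 + i)).r.degree = 2) ⊆
            (Finset.range (k - (kₑ + 1) + 1)).filter (fun i => (c (kₑ + 1 + i)).r.degree = 2) := by
          intro i hi
          simp only [Finset.mem_filter, Finset.mem_range] at hi ⊢
          exact ⟨by omega, hi.2⟩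
        have hmem : k - (kₑ + 1) ∈ (Finset.range (k - (kₑ + 1) + 1)).filter (fun i => (c (kₑ + 1 + i)).r.degree = 2) := by
          simp only [Finset.mem_filter, Finset.mem_range]
          exact ⟨by omega, by rwa [show kₑ + 1 + (k - (kₑ + 1)) = k by omega]⟩
        have hnot : k - (kₑ + 1) ∉ (Finset.range n).filter (fun i => (c (kₑ + 1 + i)).r.degree = 2) := by
          simp only [Finset.mem_filter, Finset.mem_range, not_and]
          intro h; omega
        have := Finset.card_lt_card ⟨hsub, fun h => hnot (h hmem)⟩
        omega
    obtain ⟨n, hn⟩ := hgrow (Φ (kₑ + 1) f₀ + 1)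
    obtain ⟨f, -, hbound⟩ := hprop n
    omega
  -- … so the tail is `(2,1)^ω`, every step hits the letter born just before: a FREE tail, against FT
  obtain ⟨k₂, hk₂, hne2⟩ := hev
  refine no_tail_of_eventually_free p hc hw (k₁ := k₂) fun k hk => ?_
  have h3k : (c k).r.degree = 3 := by
    have := hne2 k hk; obtain ⟨-, hge, hle⟩ := hD k (by omega); omega
  have h3k1 : (c (k + 1)).r.degree = 3 := by
    have := hne2 (k + 1) (by omega); obtain ⟨-, hge, hle⟩ := hD (k + 1) (by omega); omega
  obtain ⟨W, hW, -⟩ := hcl₁ k (by omega)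
  have hnew : (c (k + 1)).r (j k) = 2 := (heavyLine_hit_of_class (r := fun k => (c k).r) hdp hlaw₁ hcl₁ (by omega) h3k hW).2
  exact (heavyLine_hit_of_class (r := fun k => (c k).r) hdp hlaw₁ hcl₁ (k := k + 1) (by omega) h3k1 hnew).1

/-- **THE `(p, p−1)` HEAVY CLASS IS EMPTY GIVEN E_p AND L_p (p-GENERIC, K_p discharged).**  On a witnessed isolated above-floor
`Step0 p` chain with `x^{r₀} ∣ F₀`, shade `≡ d` (`d + 1 = p`, `p ≥ 3`) and `e_G ≡ 2` from `k₀`, in the heavy class from `k₁ ≥ k₀`, ASSUMING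
the entry law `hE` (at a `(2,1)`-state with heavy letter `W` an EntryInv_p frame exists) and the LOSE-H law `hL` (at a `(2,1)`-state an
EntryInv_p frame passes to a RunInv_p frame of the child with heavy letter `j k` and `betaS` not larger): `False` —
`no_heavyLine_tail_of_potential` with `E := EntryInv_p`, `R := RunInv_p`, `Φ := betaS`, the KEEP-H law being `heavyLine_stub_keep`.
At `p = 5` (with W₄ discharging the class) this is `no_dInf_tail_four_five_of_EL` up to the α-clause of the interface. [OURS]
[cite: CossartJannsenSaito2020, Lemma 13.4 (3), Thm. 13.7] [cite: CossartPiltant2008, (16)] -/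
theorem no_heavyLine_tail_of_EL {c : ℕ → State K} {j : ℕ → Fin 4} {b : ℕ → Fin 4 → K}
    (hc : ∀ k, IsIsolated p (c k).F ∧ Step0 p (c k) (c (k + 1))) (hw : FreeTail.IsWitnessedChain p c j b)
    (hr0 : ∀ e ∈ (c 0).F.support, (c 0).r ≤ e) (hfloor : ∀ k, ordZero (c k).F ≠ p) {k₀ d : ℕ} (hdp : d + 1 = p) (hp3 : 3 ≤ p)
    (hshade : ∀ k, k₀ ≤ k → (c k).shade = (d : ℕ∞))
    (he : ∀ k, k₀ ≤ k → Module.finrank K (resVertex (c k)) = 2) {k₁ : ℕ} (hk₁ : k₀ ≤ k₁)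
    (hD : ∀ k, k₁ ≤ k → (∃ W, (c k).r W = 2 ∧ ∀ i, i ≠ W → (c k).r i ≤ 1) ∧
      (2 ≤ (c k).r.degree ∧ (c k).r.degree ≤ 3))
    (hE : ∀ k, k₁ ≤ k → (c k).r.degree = 3 → ∀ (W : Fin 4), (c k).r W = 2 →
      ∃ (L : Fin (2 + 2) → Fin 4 → K) (M : Fin 4 → Fin (2 + 2) → K),
        (∀ t u, ∑ i, M t i * L i u = if t = u then 1 else 0) ∧ L (u1 2) = Pi.single W 1 ∧
        (∀ i, i ≠ u1 2 → i ≠ u2 2 → ∀ w ∈ resVertex (c k), ∑ t, L i t * w t = 0) ∧ (c k).r W = 2 ∧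
        (pts (fun i => algebraMap (MvPolynomial (Fin 4) K) (OriginLocalization K 4) (∑ t, C (L i t) * X t))
          (Ideal.span {algebraMap (MvPolynomial (Fin 4) K) (OriginLocalization K 4)
            ((c k).F.divMonomial (c k).r)}) d).Nonempty ∧
        Nat.factorial d < deltaS (fun i => algebraMap (MvPolynomial (Fin 4) K) (OriginLocalization K 4) (∑ t, C (L i t) * X t))
          (Ideal.span {algebraMap (MvPolynomial (Fin 4) K) (OriginLocalization K 4)
            ((c k).F.divMonomial (c k).r)}) d ∧
        d * alphaS (fun i => algebraMap (MvPolynomial (Fin 4) K) (OriginLocalization K 4) (∑ t, C (L i t) * X t))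
          (Ideal.span {algebraMap (MvPolynomial (Fin 4) K) (OriginLocalization K 4)
            ((c k).F.divMonomial (c k).r)}) d ≤ (d - 2) * Nat.factorial d)
    (hL : ∀ k, k₁ ≤ k → (c k).r.degree = 3 → ∀ (h : Fin 4) (L : Fin (2 + 2) → Fin 4 → K) (M : Fin 4 → Fin (2 + 2) → K),
      ((∀ t u, ∑ i, M t i * L i u = if t = u then 1 else 0) ∧ L (u1 2) = Pi.single h 1 ∧
        (∀ i, i ≠ u1 2 → i ≠ u2 2 → ∀ w ∈ resVertex (c k), ∑ t, L i t * w t = 0) ∧ (c k).r h = 2 ∧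
        (pts (fun i => algebraMap (MvPolynomial (Fin 4) K) (OriginLocalization K 4) (∑ t, C (L i t) * X t))
          (Ideal.span {algebraMap (MvPolynomial (Fin 4) K) (OriginLocalization K 4)
            ((c k).F.divMonomial (c k).r)}) d).Nonempty ∧
        Nat.factorial d < deltaS (fun i => algebraMap (MvPolynomial (Fin 4) K) (OriginLocalization K 4) (∑ t, C (L i t) * X t))
          (Ideal.span {algebraMap (MvPolynomial (Fin 4) K) (OriginLocalization K 4)
            ((c k).F.divMonomial (c k).r)}) d ∧
        d * alphaS (fun i => algebraMap (MvPolynomial (Fin 4) K) (OriginLocalization K 4) (∑ t, C (L i t) * X t))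
          (Ideal.span {algebraMap (MvPolynomial (Fin 4) K) (OriginLocalization K 4)
            ((c k).F.divMonomial (c k).r)}) d ≤ (d - 2) * Nat.factorial d) →
      ∃ (L' : Fin (2 + 2) → Fin 4 → K) (M' : Fin 4 → Fin (2 + 2) → K),
        (((∀ t u, ∑ i, M' t i * L' i u = if t = u then 1 else 0) ∧ L' (u1 2) = Pi.single (j k) 1 ∧
            (∀ i, i ≠ u1 2 → i ≠ u2 2 → ∀ w ∈ resVertex (c (k + 1)), ∑ t, L' i t * w t = 0) ∧ (c (k + 1)).r (j k) = 2 ∧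
            (pts (fun i => algebraMap (MvPolynomial (Fin 4) K) (OriginLocalization K 4) (∑ t, C (L' i t) * X t))
              (Ideal.span {algebraMap (MvPolynomial (Fin 4) K) (OriginLocalization K 4)
            ((c (k + 1)).F.divMonomial (c (k + 1)).r)}) d).Nonempty ∧
            Nat.factorial d < deltaS (fun i => algebraMap (MvPolynomial (Fin 4) K) (OriginLocalization K 4) (∑ t, C (L' i t) * X t))
              (Ideal.span {algebraMap (MvPolynomial (Fin 4) K) (OriginLocalization K 4)
            ((c (k + 1)).F.divMonomial (c (k + 1)).r)}) d ∧
            d * alphaS (fun i => algebraMap (MvPolynomial (Fin 4) K) (OriginLocalization K 4) (∑ t, C (L' i t) * X t))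
              (Ideal.span {algebraMap (MvPolynomial (Fin 4) K) (OriginLocalization K 4)
            ((c (k + 1)).F.divMonomial (c (k + 1)).r)}) d ≤ (d - 2) * Nat.factorial d) ∧
          0 < alphaS (fun i => algebraMap (MvPolynomial (Fin 4) K) (OriginLocalization K 4) (∑ t, C (L' i t) * X t))
            (Ideal.span {algebraMap (MvPolynomial (Fin 4) K) (OriginLocalization K 4)
            ((c (k + 1)).F.divMonomial (c (k + 1)).r)}) d) ∧
        betaS (fun i => algebraMap (MvPolynomial (Fin 4) K) (OriginLocalization K 4) (∑ t, C (L' i t) * X t))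
          (Ideal.span {algebraMap (MvPolynomial (Fin 4) K) (OriginLocalization K 4)
            ((c (k + 1)).F.divMonomial (c (k + 1)).r)}) d ≤
          betaS (fun i => algebraMap (MvPolynomial (Fin 4) K) (OriginLocalization K 4) (∑ t, C (L i t) * X t))
          (Ideal.span {algebraMap (MvPolynomial (Fin 4) K) (OriginLocalization K 4)
            ((c k).F.divMonomial (c k).r)}) d) : False := by
  refine no_heavyLine_tail_of_potential p hc hw hr0 hfloor hdp hshade hk₁ hD
    (Fr := Fin 4 × ((Fin (2 + 2) → Fin 4 → K) × (Fin 4 → Fin (2 + 2) → K)))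
    (fun k f =>
      (∀ t u, ∑ i, f.2.2 t i * f.2.1 i u = if t = u then 1 else 0) ∧ f.2.1 (u1 2) = Pi.single f.1 1 ∧
      (∀ i, i ≠ u1 2 → i ≠ u2 2 → ∀ w ∈ resVertex (c k), ∑ t, f.2.1 i t * w t = 0) ∧ (c k).r f.1 = 2 ∧
      (pts (fun i => algebraMap (MvPolynomial (Fin 4) K) (OriginLocalization K 4) (∑ t, C (f.2.1 i t) * X t))
        (Ideal.span {algebraMap (MvPolynomial (Fin 4) K) (OriginLocalization K 4)
            ((c k).F.divMonomial (c k).r)}) d).Nonempty ∧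
      Nat.factorial d < deltaS (fun i => algebraMap (MvPolynomial (Fin 4) K) (OriginLocalization K 4) (∑ t, C (f.2.1 i t) * X t))
        (Ideal.span {algebraMap (MvPolynomial (Fin 4) K) (OriginLocalization K 4)
            ((c k).F.divMonomial (c k).r)}) d ∧
      d * alphaS (fun i => algebraMap (MvPolynomial (Fin 4) K) (OriginLocalization K 4) (∑ t, C (f.2.1 i t) * X t))
        (Ideal.span {algebraMap (MvPolynomial (Fin 4) K) (OriginLocalization K 4)
            ((c k).F.divMonomial (c k).r)}) d ≤ (d - 2) * Nat.factorial d)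
    (fun k f =>
      ((∀ t u, ∑ i, f.2.2 t i * f.2.1 i u = if t = u then 1 else 0) ∧ f.2.1 (u1 2) = Pi.single f.1 1 ∧
        (∀ i, i ≠ u1 2 → i ≠ u2 2 → ∀ w ∈ resVertex (c k), ∑ t, f.2.1 i t * w t = 0) ∧ (c k).r f.1 = 2 ∧
        (pts (fun i => algebraMap (MvPolynomial (Fin 4) K) (OriginLocalization K 4) (∑ t, C (f.2.1 i t) * X t))
          (Ideal.span {algebraMap (MvPolynomial (Fin 4) K) (OriginLocalization K 4)
            ((c k).F.divMonomial (c k).r)}) d).Nonempty ∧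
        Nat.factorial d < deltaS (fun i => algebraMap (MvPolynomial (Fin 4) K) (OriginLocalization K 4) (∑ t, C (f.2.1 i t) * X t))
          (Ideal.span {algebraMap (MvPolynomial (Fin 4) K) (OriginLocalization K 4)
            ((c k).F.divMonomial (c k).r)}) d ∧
        d * alphaS (fun i => algebraMap (MvPolynomial (Fin 4) K) (OriginLocalization K 4) (∑ t, C (f.2.1 i t) * X t))
          (Ideal.span {algebraMap (MvPolynomial (Fin 4) K) (OriginLocalization K 4)
            ((c k).F.divMonomial (c k).r)}) d ≤ (d - 2) * Nat.factorial d) ∧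
      0 < alphaS (fun i => algebraMap (MvPolynomial (Fin 4) K) (OriginLocalization K 4) (∑ t, C (f.2.1 i t) * X t))
        (Ideal.span {algebraMap (MvPolynomial (Fin 4) K) (OriginLocalization K 4)
            ((c k).F.divMonomial (c k).r)}) d)
    (fun k f => betaS (fun i => algebraMap (MvPolynomial (Fin 4) K) (OriginLocalization K 4) (∑ t, C (f.2.1 i t) * X t))
        (Ideal.span {algebraMap (MvPolynomial (Fin 4) K) (OriginLocalization K 4)
            ((c k).F.divMonomial (c k).r)}) d)
    ?_ ?_ ?_ (fun _ _ hR => hR.1)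
  · -- E_p: the entry frame
    intro k hk h3
    obtain ⟨⟨W, hW, -⟩, -⟩ := hD k hk
    obtain ⟨L, M, hEk⟩ := hE k hk h3 W hW
    exact ⟨⟨W, L, M⟩, hEk⟩
  · -- L_p: the LOSE-H law
    rintro k hk h3 ⟨h, L, M⟩ hEk
    obtain ⟨L', M', hR', hle⟩ := hL k hk h3 h L M hEk
    exact ⟨⟨j k, L', M'⟩, hR', hle⟩
  · -- K_p: the KEEP-H law = `heavyLine_stub_keep`
    rintro k hk h2 ⟨h, L, M⟩ hR
    obtain ⟨L', M', hR', hlt⟩ := heavyLine_stub_keep p hc hw hr0 hfloor hdp hp3 hshade he hk₁ hD hk h2 hR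
    exact ⟨⟨h, L', M'⟩, hR', hlt⟩

/-- **THE `(p, p−1)` D∞-SHAPE CLASS IS EMPTY, EVERY PRIME `p ≥ 3` (the heavy line, p-GENERIC, unconditional in E/K/L).**  Along a
witnessed isolated above-floor `Step0 p` chain with `x^{r₀} ∣ F₀`, constant shade `d` (`d + 1 = p`) and `e_G ≡ 2` from `k₀`, no tail from
`k₁ ≥ k₀` lies in the D∞-shape class (one weight-`2` letter, the others `≤ 1`, `2 ≤ |r_k| ≤ 3`): `no_heavyLine_tail_of_EL` with
`hE := heavy_entryFrame` (res-dim4-p-9 g5; `n = d − 1`, transversality by `heavyLine_hit_of_class`) and `hL := heavy_lose_step`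
(res-dim4-p-2 g5; dressed with `tail_factorisation` / `tail_step_factorisation` and `heavyLine_hit_of_class`).  At `p = 5` with W₄'s
`four_weights_dichotomy` this is `no_dInf_tail_four_five` (p707872) again; at `p ≥ 7` it kills ONE recurrent class of the `(p, p−1)`
weight ledger (holder's caveat of record). [OURS] [cite: CossartJannsenSaito2020, Thm. 3.14, Lemma 13.4 (3), Thm. 13.7]
[cite: CossartPiltant2008, (16), Lemma 4.5 (2)] -/
theorem no_heavyLine_tail {c : ℕ → State K} {j : ℕ → Fin 4} {b : ℕ → Fin 4 → K}
    (hc : ∀ k, IsIsolated p (c k).F ∧ Step0 p (c k) (c (k + 1))) (hw : FreeTail.IsWitnessedChain p c j b)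
    (hr0 : ∀ e ∈ (c 0).F.support, (c 0).r ≤ e) (hfloor : ∀ k, ordZero (c k).F ≠ p) {k₀ d : ℕ} (hdp : d + 1 = p) (hp3 : 3 ≤ p)
    (hshade : ∀ k, k₀ ≤ k → (c k).shade = (d : ℕ∞))
    (he : ∀ k, k₀ ≤ k → Module.finrank K (resVertex (c k)) = 2) {k₁ : ℕ} (hk₁ : k₀ ≤ k₁)
    (hD : ∀ k, k₁ ≤ k → (∃ W, (c k).r W = 2 ∧ ∀ i, i ≠ W → (c k).r i ≤ 1) ∧
      (2 ≤ (c k).r.degree ∧ (c k).r.degree ≤ 3)) : False := by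
  obtain ⟨-, hlaw, hbj, -, -⟩ := tail_weights_laws hc hw hr0 hfloor hshade
  have hlaw₁ : ∀ k, k₁ ≤ k →
      (c (k + 1)).r = ((c k).r.filter (fun i => b k i = 0)).update (j k) ((c k).r.degree + d - p) :=
    fun k hk => hlaw k (by omega)
  have hcl₁ : ∀ k, k₁ ≤ k → ∃ W, (c k).r W = 2 ∧ ∀ i, i ≠ W → (c k).r i ≤ 1 := fun k hk => (hD k hk).1
  refine no_heavyLine_tail_of_EL p hc hw hr0 hfloor hdp hp3 hshade he hk₁ hD ?_ ?_
  · -- E_p := `heavy_entryFrame` at the `(2,1)`-state, transversal because the step hits the heavy letter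
    intro k hk h3 W hW
    obtain ⟨hhit, -⟩ := heavyLine_hit_of_class (r := fun k => (c k).r) hdp hlaw₁ hcl₁ hk h3 hW
    obtain ⟨L, M, hM, hLu1, hy, hne, hδ, hα⟩ := heavy_entryFrame (p := p) (d := d) (n := d - 1) (by omega) (by omega)
      hc hw hr0 hfloor hshade he (k := k) (by omega) (W := W) (by rw [hW]; omega)
      (heavyLine_direction_ne_zero (hbj k) hhit)
    refine ⟨L, M, hM, hLu1, hy, hW, hne, hδ, ?_⟩
    rwa [show d - 1 - 1 = d - 2 by omega] at hα
  · -- L_p := `heavy_lose_step` at the `(2,1)`-state, dressed with the tail factorisations and the HIT-H pattern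
    intro k hk h3 h L M hEk
    obtain ⟨hM, hLu1, hy, hrh, hne, hδ, -⟩ := hEk
    have hk0 : k₀ ≤ k := by omega
    have hk1 : k₀ ≤ k + 1 := by omega
    obtain ⟨hF, hd, hpo, ho2, hdiv⟩ := tail_factorisation hc hr0 hfloor hshade hk0
    obtain ⟨hF', -⟩ := tail_step_factorisation hc hw hr0 hfloor hshade hk0
    obtain ⟨hF₁, hd₁, -, -, -⟩ := tail_factorisation hc hr0 hfloor hshade hk1
    obtain ⟨hhit, hr'⟩ := heavyLine_hit_of_class (r := fun k => (c k).r) hdp hlaw₁ hcl₁ hk h3 hrh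
    have hck1 : c (k + 1) = CentreBlowup.step p Finset.univ (j k) (b k) (c k) := (hw k).2.2.2.2
    have hshade_eq : (CentreBlowup.step p Finset.univ (j k) (b k) (c k)).shade = (c k).shade := by
      rw [← hck1, hshade (k + 1) hk1, hshade k hk0]
    have hr'' : (c (k + 1)).r (j k) = (c k).r.degree + d - p := by
      rw [hr', h3]; omega
    obtain ⟨L', M', ⟨hM', hL'u1, hy', hne', hδ', hα'⟩, hpos, hle⟩ :=
      heavy_lose_step (p := p) (d := d) (n := d - 1) (by omega) (by omega) (by omega) (by rw [h3]; omega) hpo ho2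
        (by rw [h3, show 3 + d - p = 2 by omega]; intro hdvd; have := Nat.le_of_dvd two_pos hdvd; omega)
        hF hd hdiv (hbj k) hF' hF₁ hd₁ (hc (k + 1)).1 hshade_eq (he k hk0) (he (k + 1) hk1) hhit hr'' hM hLu1 hy hne hδ
    refine ⟨L', M', ⟨⟨hM', hL'u1, hy', ?_, hne', hδ', ?_⟩, hpos⟩, hle⟩
    · exact hr'
    · rwa [show d - 1 - 1 = d - 2 by omega] at hα'

end ResCone

end Summit.ResolutionOfSingularities.ResolutionOfSingularities.Theorems.PIDim4

end
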